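import Summits.BirchSwinnertonDyer.BirchSwinnertonDyer.Theses.ResidualThetaTransportAtTwo
import Summits.BirchSwinnertonDyer.BirchSwinnertonDyer.Theorems.ResidualThetaTransportAtTwoResidualThetaMainConjectureAtTwoLowerCount
import HarnessLib

/-!
# KλP `ResidualThetaMainConjectureAtTwoOfLowerCount` (route `ResidualThetaTransportAtTwo`, support r9, RTT rev «RMC-V1»,
# director-bsd W-74) — the ONE-LINE CLOSER

The support decl `ResidualThetaMainConjectureAtTwoOfLowerCount` is, BY NAME, the implication
`ResidualLambdaFormulaNegDiscAtTwo → ResidualThetaCountLowerAtTwo → SignedKatoDivisibilityUpToAtTwo →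
ThetaLayerLambdaCongruenceAtTwo → ResidualThetaMainConjectureAtTwo` (RLF → RTC≥ → K3 → Kan⁺ → Kλ⁺). It is PROVED by the
landed composition `…Theorems.ResidualThetaLayer.residualThetaMainConjectureAtTwo_of_lowerCount` (p593028, lead rtt-p2 g5; the
v12 skeleton's `_of`), since the new crux `ResidualThetaCountLowerAtTwo` (RTC≥) is the birth-v12 stub
`stub_residualThetaCountLowerAtTwo` verbatim (pen cert `item_eq_stub : … := Iff.rfl`). Lead rtt-p2 g7. BSD is not proved by this:
Kλ⁺ still waits on the items RLF (23110), RTC≥, K3 (20308), Kan⁺ (20688).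
-/

set_option autoImplicit false
-- justification: the `Summit.BirchSwinnertonDyer.BirchSwinnertonDyer.…` path repeats a component (route-file convention)
set_option linter.dupNamespace false

namespace Summit.BirchSwinnertonDyer.BirchSwinnertonDyer.Theorems.ResidualThetaLayer

/-- **KλP holds**: `RLF → RTC≥ → K3 → Kan⁺ → Kλ⁺` on route `ResidualThetaTransportAtTwo`, by the landed 4-ary composition
`residualThetaMainConjectureAtTwo_of_lowerCount` (p593028). [folklore] -/
theorem residualThetaMainConjectureAtTwoOfLowerCount_holds :
    Summit.BirchSwinnertonDyer.BirchSwinnertonDyer.Theses.ResidualThetaTransportAtTwo.ResidualThetaMainConjectureAtTwoOfLowerCount :=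
  fun hRLF hRTC hKato han ↦ residualThetaMainConjectureAtTwo_of_lowerCount hRLF hRTC hKato han

end Summit.BirchSwinnertonDyer.BirchSwinnertonDyer.Theorems.ResidualThetaLayer
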